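import Mathlib

/-!
# Crux `SkeletonJ1R` (stmt-NavierStokesRegularity-23610) · registered line `streamline_kantorovich_R` · stub K-B′ — the ALGEBRAIC CORE of the
# model-level obstruction to clause 1 of `RegularWaist` (evidence memo `KB-OUTPUT-SHAPE-DIAGNOSIS-leafhand-g2.md`, item evidence #60):
# the stagnation pair of a line vortex in a counter-rotating strained background

Hand `leafhand-ns-filamentskeletonrs-1` g2 (prover), 2026-08-31, `--supports stmt-NavierStokesRegularity-23610 --as helper`; pure Mathlib.  MODEL rung,
NEGATIVE side of the NS ladder; nothing here bears on Navier–Stokes regularity.  NOT a refutation of any registered statement: these are the exact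
finite-dimensional facts behind the memo's leading-order computation, recorded so that a disprover / planner can check the mechanism by kernel.

THE MODEL (memo §2).  Off filament `j` near its waist zero, in scaled normal coordinates `ζ ∈ ℝ²`, the rotating-frame field is `(γ/(2π|ζ|²))Jζ + B ζ`
with `B = S + bJ`, `S` symmetric (`½·1 +` partners' normal strain), `b = −α⟪e₃,T⟫`, `J` the rotation by `+90°`.  Writing `S = [[p, q], [q, s]]` and
`c = b + ω` (`ω = γ/(2π|ζ|²)`), the matrix `B + ωJ` is `[[p, q − c], [q + c, s]]`:
* `det_sym_add_rot` — its determinant is `(ps − q²) + c²`;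
* `exists_kernel_of_det_eq_zero` — when that vanishes there is a nonzero kernel vector (a zero DIRECTION of the model field);
* `det_neg_of_quadForm_pos_of_trace_neg` — if the quadratic form of `S` is `> 0` at some vector while `tr S = p + s < 0`, then `ps − q² < 0` (so the roots
  `c = ±√(q² − ps)` are real and nonzero): INDEFINITENESS of the symmetric normal block;
* `inner_partnerAxis_normalProjection` — why the block IS indefinite for `N = 2`: for a linear map `D` with `D T_k = 0` and range `⊥ T_k` (the gradient of a
  straight partner's Biot–Savart field) and a unit tangent `T`, the vector `n = T_k − ⟪T_k,T⟫T` (the partner axis projected to the normal plane of `T`) has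
  `⟪n, D n⟫ = ⟪T_k,T⟫²·⟪T, D T⟫` and `‖n‖² = ‖T_k‖² − ⟪T_k,T⟫²` — so the normal strain along `n̂` is `⟪T_k,T⟫²·s_ax/(1 − ⟪T_k,T⟫²) ≥ 0` when the axial strain
  `s_ax = ⟪T, DT⟫ ≥ 0`, whence the diagonal entry `½ + (that) ≥ ½ > 0` of `S` while `tr S = 1 − s_ax ≤ −δ/2`;
* `stagnation_roots` — packaging: `ps − q² < 0` ⇒ with `r = √(q² − ps) > 0` both `c = r` and `c = −r` annihilate the determinant, and if `|b| < r` the two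
  swirl values `ω± = −b ± r` have opposite signs (one of them matches any prescribed sign of `γ`), the model zero sitting at `|ζ⋆|² = γ/(2π ω)`.
[folklore]
-/

set_option linter.dupNamespace false -- `NavierStokesRegularity.NavierStokesRegularity` path/namespace repetition is the tree convention

noncomputable section

namespace Summit.NavierStokesRegularity.NavierStokesRegularity.Theorems.SkeletonJ1RFrame.WaistStagnationModel

open scoped InnerProductSpace

/-! ## §1 The 2×2 bordered-rotation determinant and its kernel -/

/-- `det [[p, q − c], [q + c, s]] = (ps − q²) + c²`: adding a rotation `cJ` to a symmetric `2×2` matrix raises the determinant by `c²`. [folklore] -/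
theorem det_sym_add_rot (p q s c : ℝ) : p * s - (q - c) * (q + c) = (p * s - q ^ 2) + c ^ 2 := by ring

/-- A `2×2` real matrix `[[p, q − c], [q + c, s]]` with vanishing determinant has a nonzero kernel vector. [folklore] -/
theorem exists_kernel_of_det_eq_zero {p q s c : ℝ} (hdet : p * s - (q - c) * (q + c) = 0) :
    ∃ z : ℝ × ℝ, z ≠ 0 ∧ p * z.1 + (q - c) * z.2 = 0 ∧ (q + c) * z.1 + s * z.2 = 0 := by
  by_cases h1 : p = 0 ∧ q - c = 0
  · -- first row vanishes: take a kernel vector of the second row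
    obtain ⟨hp, hqc⟩ := h1
    by_cases h2 : s = 0
    · refine ⟨(0, 1), by simp, by simp [hp, hqc], by simp [h2]⟩
    · refine ⟨(s, -(q + c)), ?_, ?_, ?_⟩
      · intro h; apply h2; simpa using congrArg Prod.fst h
      · simp [hp, hqc]
      · ring
  · -- first row `(p, q − c) ≠ 0`: the vector `(−(q − c), p)` is ⊥ to it, and the second row kills it by the determinant
    refine ⟨(-(q - c), p), ?_, by ring, ?_⟩
    · intro h
      apply h1
      have h1' : -(q - c) = 0 := by simpa using congrArg Prod.fst h
      have h2' : p = 0 := by simpa using congrArg Prod.snd h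
      exact ⟨h2', by linarith⟩
    · have : (q + c) * (-(q - c)) + s * p = p * s - (q - c) * (q + c) := by ring
      rw [this, hdet]

/-! ## §2 Indefiniteness of the symmetric normal block -/

/-- If the quadratic form of the symmetric matrix `[[p, q], [q, s]]` is positive at some vector while its trace is negative, its determinant is negative
(the form is indefinite).  Elementary: `ps − q² ≥ 0` with `p + s < 0` forces `p, s ≤ 0` and then `p v₁² + 2q v₁v₂ + s v₂² ≤ 0` everywhere. [folklore] -/
theorem det_neg_of_quadForm_pos_of_trace_neg {p q s v₁ v₂ : ℝ} (hpos : 0 < p * v₁ ^ 2 + 2 * q * v₁ * v₂ + s * v₂ ^ 2)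
    (htr : p + s < 0) : p * s - q ^ 2 < 0 := by
  by_contra h
  push Not at h
  -- `p ≤ 0` and `s ≤ 0`
  have hp : p ≤ 0 := by
    by_contra hp'
    push Not at hp'
    have hs : s < 0 := by linarith
    nlinarith [sq_nonneg q]
  have hs : s ≤ 0 := by
    by_contra hs'
    push Not at hs'
    have hp'' : p < 0 := by linarith
    nlinarith [sq_nonneg q]
  -- the form is `≤ 0`: `2|q v₁ v₂| ≤ (−p) v₁² + (−s) v₂²` since `q² ≤ ps`
  nlinarith [sq_nonneg (p * v₁ + q * v₂), sq_nonneg (q * v₁ + s * v₂), sq_nonneg v₁, sq_nonneg v₂,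
    mul_nonneg (neg_nonneg.mpr hp) (sq_nonneg v₁), mul_nonneg (neg_nonneg.mpr hs) (sq_nonneg v₂)]

/-! ## §3 Why the block is indefinite for one straight partner: the partner-axis direction carries non-negative normal strain -/

/-- For a linear map `D` on a real inner product space with `D T_k = 0` and range orthogonal to `T_k` (the velocity gradient of a STRAIGHT partner filament
with axis `T_k`), and any vector `T`: the projection `n = T_k − ⟪T_k, T⟫ T` of the partner axis satisfies `⟪n, D n⟫ = ⟪T_k,T⟫² ⟪T, D T⟫`. [folklore] -/
theorem inner_partnerAxis_normalProjection {E : Type*} [NormedAddCommGroup E] [InnerProductSpace ℝ E] (D : E →ₗ[ℝ] E) {Tk T : E}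
    (hker : D Tk = 0) (hrange : ∀ v, ⟪Tk, D v⟫_ℝ = 0) :
    ⟪Tk - ⟪Tk, T⟫_ℝ • T, D (Tk - ⟪Tk, T⟫_ℝ • T)⟫_ℝ = ⟪Tk, T⟫_ℝ ^ 2 * ⟪T, D T⟫_ℝ := by
  have hD : D (Tk - ⟪Tk, T⟫_ℝ • T) = -(⟪Tk, T⟫_ℝ • D T) := by
    rw [map_sub, map_smul, hker, zero_sub]
  rw [hD, inner_neg_right, inner_sub_left, inner_smul_right, inner_smul_left, inner_smul_right, hrange]
  simp only [RCLike.conj_to_real]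
  ring

/-- … and `‖n‖² = ‖T_k‖² − ⟪T_k,T⟫²` when `‖T‖ = 1` (so for unit `T_k ∦ T` the unit vector `n̂` has `⟪n̂, D n̂⟫ = ⟪T_k,T⟫² ⟪T,DT⟫/(1 − ⟪T_k,T⟫²)`,
non-negative as soon as the axial strain `⟪T, D T⟫` is). [folklore] -/
theorem norm_sq_partnerAxis_normalProjection {E : Type*} [NormedAddCommGroup E] [InnerProductSpace ℝ E] {Tk T : E} (hT : ‖T‖ = 1) :
    ‖Tk - ⟪Tk, T⟫_ℝ • T‖ ^ 2 = ‖Tk‖ ^ 2 - ⟪Tk, T⟫_ℝ ^ 2 := by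
  rw [@norm_sub_sq_real, norm_smul, Real.norm_eq_abs, hT, mul_one, sq_abs, inner_smul_right, real_inner_comm T Tk]
  ring

/-- The diagonal entry of `S = ½·1 + (normal strain)` along `n̂` is at least `½` when the axial strain is non-negative: with `a = ⟪T_k,T⟫`, `|a| < 1`,
`s_ax ≥ 0`: `½ + a² s_ax/(1 − a²) ≥ ½`; together with `tr S = 1 − s_ax ≤ −δ/2` (axial strain `≥ 1 + δ/2`) the hypotheses of
`det_neg_of_quadForm_pos_of_trace_neg` hold. [folklore] -/
theorem half_le_diag_entry {a sax : ℝ} (ha : a ^ 2 < 1) (hsax : 0 ≤ sax) : (1:ℝ) / 2 ≤ 1 / 2 + a ^ 2 * sax / (1 - a ^ 2) := by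
  have : 0 ≤ a ^ 2 * sax / (1 - a ^ 2) := div_nonneg (mul_nonneg (sq_nonneg a) hsax) (by linarith)
  linarith

/-! ## §4 The stagnation roots -/

/-- ★ **Stagnation roots.**  If the symmetric normal block `[[p,q],[q,s]]` is indefinite (`ps − q² < 0`), then `r := √(q² − ps) > 0`, both rotations
`c = r` and `c = −r` make `[[p, q − c],[q + c, s]]` singular (a zero direction of the model field `(γ/(2π|ζ|²))J + S + bJ` at swirl value `ω = c − b`),
and when `|b| < r` the two swirl values `r − b` and `−r − b` have OPPOSITE signs — one of them has the sign of any prescribed circulation `γ ≠ 0`, placing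
the model's stagnation pair at `|ζ⋆|² = γ/(2π ω)`. [folklore] -/
theorem stagnation_roots {p q s b : ℝ} (hdet : p * s - q ^ 2 < 0) (hb : |b| < Real.sqrt (q ^ 2 - p * s)) :
    0 < Real.sqrt (q ^ 2 - p * s) ∧
      p * s - (q - Real.sqrt (q ^ 2 - p * s)) * (q + Real.sqrt (q ^ 2 - p * s)) = 0 ∧
      p * s - (q - -Real.sqrt (q ^ 2 - p * s)) * (q + -Real.sqrt (q ^ 2 - p * s)) = 0 ∧
      0 < Real.sqrt (q ^ 2 - p * s) - b ∧ -Real.sqrt (q ^ 2 - p * s) - b < 0 := by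
  set r := Real.sqrt (q ^ 2 - p * s) with hr
  have hpos : 0 < q ^ 2 - p * s := by linarith
  have hr2 : r ^ 2 = q ^ 2 - p * s := by rw [hr, Real.sq_sqrt hpos.le]
  have hrpos : 0 < r := Real.sqrt_pos.mpr hpos
  have hb1 : b < r := lt_of_le_of_lt (le_abs_self b) hb
  have hb2 : -r < b := by
    have := neg_abs_le b
    linarith
  refine ⟨hrpos, ?_, ?_, by linarith, by linarith⟩
  · rw [det_sym_add_rot, hr2]; ring
  · rw [det_sym_add_rot, neg_sq, hr2]; ring

/-- The zero direction at a stagnation root, explicitly: for `c` with `(ps − q²) + c² = 0` there is `z ≠ 0` in the kernel of `[[p, q − c],[q + c, s]]`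
(combine `det_sym_add_rot` and `exists_kernel_of_det_eq_zero`). [folklore] -/
theorem exists_zero_direction {p q s c : ℝ} (hc : (p * s - q ^ 2) + c ^ 2 = 0) :
    ∃ z : ℝ × ℝ, z ≠ 0 ∧ p * z.1 + (q - c) * z.2 = 0 ∧ (q + c) * z.1 + s * z.2 = 0 :=
  exists_kernel_of_det_eq_zero (by rw [det_sym_add_rot]; exact hc)


/-! ## §5 The model field has a stagnation pair (appended by the same hand, 2026-08-31) -/

/-- ★ **The model field HAS a zero off the filament.**  In normal coordinates `ζ = (u, v)` the leading-order field off the waist is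
`F(ζ) = (γ/(2π|ζ|²))·Jζ + Bζ`, `Jζ = (−v, u)`, `B = S + bJ = [[p, q − b], [q + b, s]]`.  If the symmetric block is indefinite (`ps − q² < 0`), the frame
rotation coefficient satisfies `|b| < √(q² − ps)` and `γ ≠ 0`, then `F` vanishes at some `ζ ≠ 0`, with swirl value `ω = γ/(2π|ζ|²) ∈ {√(q²−ps) − b, −√(q²−ps) − b}`
(so `|ζ|² = γ/(2πω)`: the stagnation pair `±ζ` of a line vortex in a counter-rotating strained background; memo §2).  Construction: take the root `ω` with the
sign of `γ`, a kernel vector `z` of `B + ωJ` (singular by `det_sym_add_rot`), and rescale `z` so that the swirl value at `|ζ|` equals `ω`. [folklore] -/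
theorem model_stagnation_pair {p q s b γ : ℝ} (hdet : p * s - q ^ 2 < 0) (hb : |b| < Real.sqrt (q ^ 2 - p * s)) (hγ : γ ≠ 0) :
    ∃ u v ω : ℝ, (u, v) ≠ ((0:ℝ), (0:ℝ)) ∧ (ω = Real.sqrt (q ^ 2 - p * s) - b ∨ ω = -Real.sqrt (q ^ 2 - p * s) - b) ∧
      γ / (2 * Real.pi * (u ^ 2 + v ^ 2)) = ω ∧
      γ / (2 * Real.pi * (u ^ 2 + v ^ 2)) * (-v) + (p * u + (q - b) * v) = 0 ∧
      γ / (2 * Real.pi * (u ^ 2 + v ^ 2)) * u + ((q + b) * u + s * v) = 0 := by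
  obtain ⟨hr, hrootP, hrootM, hωP, hωM⟩ := stagnation_roots hdet hb
  set r := Real.sqrt (q ^ 2 - p * s) with hr_def
  -- the root with the sign of `γ`
  obtain ⟨ω, hωroot, hωsign, hωdet⟩ : ∃ ω : ℝ, (ω = r - b ∨ ω = -r - b) ∧ 0 < γ / ω ∧
      p * s - (q - (b + ω)) * (q + (b + ω)) = 0 := by
    rcases lt_or_gt_of_ne hγ with hneg | hpos
    · refine ⟨-r - b, Or.inr rfl, div_pos_of_neg_of_neg hneg hωM, ?_⟩
      have : b + (-r - b) = -r := by ring
      rw [this]; exact hrootM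
    · refine ⟨r - b, Or.inl rfl, div_pos hpos hωP, ?_⟩
      have : b + (r - b) = r := by ring
      rw [this]; exact hrootP
  have hωne : ω ≠ 0 := by
    rintro rfl; simp at hωsign
  -- a kernel vector of `B + ωJ = [[p, q − (b+ω)], [q + (b+ω), s]]`
  obtain ⟨z, hz0, hz1, hz2⟩ := exists_kernel_of_det_eq_zero hωdet
  have hzsq : 0 < z.1 ^ 2 + z.2 ^ 2 := by
    rcases z with ⟨z1, z2⟩
    by_contra h
    push Not at h
    have h1 : z1 = 0 := by nlinarith [sq_nonneg z1, sq_nonneg z2]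
    have h2 : z2 = 0 := by nlinarith [sq_nonneg z1, sq_nonneg z2]
    exact hz0 (by simp [h1, h2])
  -- rescale: `t² = γ/(2π ω |z|²)`
  set t : ℝ := Real.sqrt (γ / ω / (2 * Real.pi * (z.1 ^ 2 + z.2 ^ 2))) with ht_def
  have htsq_arg : 0 < γ / ω / (2 * Real.pi * (z.1 ^ 2 + z.2 ^ 2)) := by positivity
  have ht : 0 < t := Real.sqrt_pos.mpr htsq_arg
  have ht2 : t ^ 2 = γ / ω / (2 * Real.pi * (z.1 ^ 2 + z.2 ^ 2)) := by rw [ht_def, Real.sq_sqrt htsq_arg.le]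
  refine ⟨t * z.1, t * z.2, ω, ?_, hωroot, ?_, ?_, ?_⟩
  · intro h
    have h1 : t * z.1 = 0 := by simpa using congrArg Prod.fst h
    have h2 : t * z.2 = 0 := by simpa using congrArg Prod.snd h
    rcases mul_eq_zero.mp h1 with h | h
    · exact absurd h ht.ne'
    · rcases mul_eq_zero.mp h2 with h' | h'
      · exact absurd h' ht.ne'
      · rcases z with ⟨z1, z2⟩
        simp only at h h'
        exact hz0 (by simp [h, h'])
  all_goals
    have hnorm : (t * z.1) ^ 2 + (t * z.2) ^ 2 = t ^ 2 * (z.1 ^ 2 + z.2 ^ 2) := by ring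
    have hswirl : γ / (2 * Real.pi * ((t * z.1) ^ 2 + (t * z.2) ^ 2)) = ω := by
      rw [hnorm, ht2]
      field_simp
  · exact hswirl
  · rw [hswirl]
    have := congrArg (fun e => t * e) hz1
    simp only [mul_zero] at this
    linarith [this, show t * (p * z.1 + (q - (b + ω)) * z.2) = ω * -(t * z.2) + (p * (t * z.1) + (q - b) * (t * z.2)) by ring]
  · rw [hswirl]
    have := congrArg (fun e => t * e) hz2
    simp only [mul_zero] at this
    linarith [this, show t * ((q + (b + ω)) * z.1 + s * z.2) = ω * (t * z.1) + ((q + b) * (t * z.1) + s * (t * z.2)) by ring]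

end Summit.NavierStokesRegularity.NavierStokesRegularity.Theorems.SkeletonJ1RFrame.WaistStagnationModel

end
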